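import Literature.MathematicalPhysics.QuantumFieldTheory.Balaban1983to89.B4Eq19CampanatoIteration
import HarnessLib

/-!
# Route `UnitScaleTilt`, crux K1 «MinimiserStabilityRegPr» (stmt-QuantumFields-19200), EX row (5) `norm_G`, STOREY H, programme «H2-LOC» (chair WORD №60 (2)–(3)), brick (C3a) —
# **CAMPANATO'S ITERATION LEMMA WITH AN `ε`-SLACK** ([Giaquinta1984] Ch. III Lemma 2.1 p. 86, the full form with the perturbation `ε`), in the integer-exponent lattice form of
# lit ✓`B4Eq19CampanatoIteration.campanato_iteration`: a nonnegative nondecreasing `ψ` on `[1, R₀]` with `ψ(P) ≤ (A(P∕R)^d + ε)·ψ(R) + B·R^d` (`1 ≤ P ≤ R ≤ R₀`) and the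
# smallness `ε·(4A)^d ≤ A` satisfies `ψ(P) ≤ 2(4A)^{2(d−1)}·(P∕R)^{d−1}·(ψ(R) + B·R^d)`.

Cell `ym3-torus` (HUMAN RULING D-0037; rung R3 = SU(2) YM₃ on T³ — NOT d = 4, NOT infinite volume, NOT a mass gap, NOT Clay).  Width seat `ym3-torus-px21` (gen 16); chair WORD №60 (3)
pen C3 («MINE C3» 17:05Z); px19 g16's LOCATE-H2-FILE2 memo §3∕§5 (C3).  THEOREMS ONLY (0 `def`, 0 `sorry`, default heartbeats); `--supports stmt-QuantumFields-19200 --as helper`; count-neutral.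

WHY THE SLACK (memo §3 (C)).  On the curved road the Dirichlet comparison of `u` with its FLAT replacement `w` on `Q_R` prices the cross term `(R(V) − 1)∇_V u` as
`c·(ℓδ)²·Σ_{Q_R}‖∇_V u‖²` — a multiple `ε = c(ℓδ)²` of `ψ(R)` itself, not of `(P∕R)^d ψ(R)`; the iteration must carry it, and the smallness `hεA` is the memo's `ℓδ ≤ θ₀(A, d)`.

THE MATHEMATICS (lit's proof with `τ := 1∕(4A)` in place of `1∕(2A)`).  Under `ε(4A)^d ≤ A` one has `ε ≤ Aτ^d`, so at two consecutive radii
`ψ(τR) ≤ (Aτ^d + ε)ψ(R) + BR^d ≤ 2Aτ^d·ψ(R) + BR^d = (τ^{d−1}∕2)·ψ(R) + BR^d` — EXACTLY the contraction lit iterates (`iterate_step`); the geometric iteration along `τ^k R` and the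
final monotonicity comparison are then verbatim with `2A ↦ 4A`.

WHAT IS PROVED (ns `Summit.QuantumFields.YangMills.Theorems.Prop7CampanatoIterationEps`).
* `iterate_step_eps` — along `R_k = τ^k R`, `τ = 1∕(4A)`: `ψ(τ^k R) ≤ τ^{k(d−1)}·(ψ(R) + 2B R^d (4A)^{d−1})` while `τ^k R ≥ 1`.
* ★★★ `campanato_iteration_eps` — THE LEMMA: `ψ(P) ≤ 2(4A)^{2(d−1)}·(P∕R)^{d−1}·(ψ(R) + B R^d)` for `1 ≤ P ≤ R ≤ R₀` (`d ≥ 1`, `A ≥ 1`, `B ≥ 0`, `ε(4A)^d ≤ A`; no sign condition on `ε` is needed).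
* `campanato_iteration_eps_zero` — sanity: at `ε = 0` the hypothesis is lit's and the conclusion is lit's with `4A` (weaker constant, same exponent).
HONEST SCOPE.  A real-variable lemma, proved; (C3b) the covariant Campanato step ∕ Morrey bound, (C1)(C2)(C4)(C5), `hHlocV`, `hWsup`, FILE 2, norm_G, EX, 19200 and rung R3 are NOT
proved here; the Yang–Mills mass gap is NOT proved.

References: M. Giaquinta, *Multiple integrals in the calculus of variations and nonlinear elliptic systems*, Annals of Math. Studies **105**, Princeton 1983 [Giaquinta1984] (Ch. III
Lemma 2.1 p. 86); T. Bałaban, CMP **96** (1984) 223–250 [Balaban1984PropagatorsII] ((1.9) p. 226); CMP **99** (1985) 389–434 [Balaban1985BackgroundPropagators] (Thm 3.1 (3.43) p. 398).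
-/

set_option autoImplicit false

noncomputable section

namespace Summit.QuantumFields.YangMills.Theorems.Prop7CampanatoIterationEps

open Literature.MathematicalPhysics.QuantumFieldTheory.Balaban1983to89.B4Eq19CampanatoIteration (campanato_iteration)

/-- **The geometric iteration along `R_k = τ^k R`, `τ = 1∕(4A)`, with slack**: if `ψ ≥ 0` on `[1,R₀]`, `ψ(P) ≤ (A(P∕R')^d + ε)ψ(R') + B R'^d` for `1 ≤ P ≤ R' ≤ R₀`, and
`ε(4A)^d ≤ A`, then for every `k` with `τ^k R ≥ 1` (`1 ≤ R ≤ R₀`): `ψ(τ^k R) ≤ τ^{k(d−1)}·(ψ(R) + 2 B R^d (4A)^{d−1})`. [cite: Giaquinta1984, Ch. III Lemma 2.1 p.86] -/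
theorem iterate_step_eps {ψ : ℝ → ℝ} {A B ε R₀ : ℝ} {d : ℕ} (hd : 1 ≤ d) (hA : 1 ≤ A) (hB : 0 ≤ B) (hεA : ε * (4 * A) ^ d ≤ A)
    (hψ0 : ∀ t, 1 ≤ t → t ≤ R₀ → 0 ≤ ψ t)
    (hyp : ∀ P R, 1 ≤ P → P ≤ R → R ≤ R₀ → ψ P ≤ (A * (P / R) ^ d + ε) * ψ R + B * R ^ d)
    {R : ℝ} (hR1 : 1 ≤ R) (hR : R ≤ R₀) :
    ∀ k : ℕ, 1 ≤ (1 / (4 * A)) ^ k * R →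
      ψ ((1 / (4 * A)) ^ k * R) ≤ ((1 / (4 * A)) ^ k) ^ (d - 1) * (ψ R + 2 * B * R ^ d * (4 * A) ^ (d - 1)) := by
  set τ : ℝ := 1 / (4 * A) with hτ
  have hA0 : 0 < A := by linarith
  have hτ0 : 0 < τ := by rw [hτ]; positivity
  have hτ1 : τ ≤ 1 := by rw [hτ, div_le_one (by positivity)]; linarith
  have hτA : τ * (4 * A) = 1 := by rw [hτ]; field_simp
  have hτinv : (4 * A) ^ (d - 1) * τ ^ (d - 1) = 1 := by rw [← mul_pow, mul_comm, hτA, one_pow]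
  have hτd : τ ^ d * (4 * A) ^ d = 1 := by rw [← mul_pow, hτA, one_pow]
  -- the slack is at most `A τ^d`
  have hεd : ε ≤ A * τ ^ d := by
    have h1 : ε = ε * (4 * A) ^ d * τ ^ d := by rw [mul_assoc, mul_comm ((4 * A) ^ d), hτd, mul_one]
    rw [h1]
    exact mul_le_mul_of_nonneg_right hεA (pow_nonneg hτ0.le d) |>.trans (le_of_eq (by ring))
  have hR0 : 0 < R := by linarith
  set M : ℝ := ψ R + 2 * B * R ^ d * (4 * A) ^ (d - 1) with hM
  have hψR : 0 ≤ ψ R := hψ0 R hR1 hR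
  intro k
  induction k with
  | zero =>
    intro _
    simp only [pow_zero, one_mul, one_pow]
    rw [hM]
    have : 0 ≤ 2 * B * R ^ d * (4 * A) ^ (d - 1) := by positivity
    linarith
  | succ k ih =>
    intro hk1
    have hk0 : 1 ≤ τ ^ k * R := by
      have : τ ^ (k + 1) * R ≤ τ ^ k * R := by
        rw [pow_succ]
        have : τ ^ k * τ ≤ τ ^ k * 1 := mul_le_mul_of_nonneg_left hτ1 (by positivity)
        nlinarith
      linarith
    have hkR : τ ^ k * R ≤ R := by
      have : τ ^ k ≤ 1 := pow_le_one₀ hτ0.le hτ1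
      nlinarith
    have ihk := ih hk0
    -- one step of the hypothesis between `τ^{k+1}R` and `τ^k R`
    have hstep := hyp (τ ^ (k + 1) * R) (τ ^ k * R) hk1 (by
      rw [pow_succ]; have : τ ^ k * τ ≤ τ ^ k * 1 := mul_le_mul_of_nonneg_left hτ1 (by positivity); nlinarith) (hkR.trans hR)
    have hratio : τ ^ (k + 1) * R / (τ ^ k * R) = τ := by
      rw [pow_succ]; field_simp
    rw [hratio] at hstep
    -- `2A τ^d = τ^{d-1}/2`
    have hAτ : 2 * A * τ ^ d = τ ^ (d - 1) / 2 := by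
      have : τ ^ d = τ ^ (d - 1) * τ := by rw [← pow_succ]; congr 1; omega
      rw [this, hτ]; field_simp; ring
    have hψk0 : 0 ≤ ψ (τ ^ k * R) := hψ0 _ hk0 (hkR.trans hR)
    -- absorb the slack: `(Aτ^d + ε) ψ ≤ 2Aτ^d ψ`
    have hstep' : ψ (τ ^ (k + 1) * R) ≤ τ ^ (d - 1) / 2 * ψ (τ ^ k * R) + B * (τ ^ k * R) ^ d := by
      have h1 : (A * τ ^ d + ε) * ψ (τ ^ k * R) ≤ (2 * A * τ ^ d) * ψ (τ ^ k * R) :=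
        mul_le_mul_of_nonneg_right (by linarith) hψk0
      rw [hAτ] at h1
      linarith
    have hpow : (τ ^ k * R) ^ d = (τ ^ k) ^ (d - 1) * τ ^ k * R ^ d := by
      have : (τ ^ k * R) ^ d = (τ ^ k) ^ d * R ^ d := mul_pow _ _ _
      rw [this, show (τ ^ k) ^ d = (τ ^ k) ^ (d - 1) * τ ^ k by rw [← pow_succ]; congr 1; omega]
    have hτk1 : τ ^ k ≤ 1 := pow_le_one₀ hτ0.le hτ1
    have hkey : B * (τ ^ k * R) ^ d ≤ (τ ^ k) ^ (d - 1) * τ ^ (d - 1) * (B * R ^ d * (4 * A) ^ (d - 1)) := by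
      rw [hpow]
      have e : (τ ^ k) ^ (d - 1) * τ ^ (d - 1) * (B * R ^ d * (4 * A) ^ (d - 1)) =
          (τ ^ k) ^ (d - 1) * (B * R ^ d) * ((4 * A) ^ (d - 1) * τ ^ (d - 1)) := by ring
      rw [e, hτinv, mul_one]
      have h1 : B * ((τ ^ k) ^ (d - 1) * τ ^ k * R ^ d) = (τ ^ k) ^ (d - 1) * (B * R ^ d) * τ ^ k := by ring
      rw [h1]
      have h2 : 0 ≤ (τ ^ k) ^ (d - 1) * (B * R ^ d) := by positivity
      nlinarith
    have htarget : (τ ^ (k + 1)) ^ (d - 1) * M = (τ ^ k) ^ (d - 1) * τ ^ (d - 1) * M := by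
      rw [pow_succ, mul_pow]
    rw [htarget]
    calc ψ (τ ^ (k + 1) * R) ≤ τ ^ (d - 1) / 2 * ψ (τ ^ k * R) + B * (τ ^ k * R) ^ d := hstep'
      _ ≤ τ ^ (d - 1) / 2 * ((τ ^ k) ^ (d - 1) * M) + (τ ^ k) ^ (d - 1) * τ ^ (d - 1) * (B * R ^ d * (4 * A) ^ (d - 1)) := by
          have := mul_le_mul_of_nonneg_left ihk (by positivity : (0:ℝ) ≤ τ ^ (d - 1) / 2)
          linarith
      _ = (τ ^ k) ^ (d - 1) * τ ^ (d - 1) * (M / 2 + B * R ^ d * (4 * A) ^ (d - 1)) := by ring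
      _ ≤ (τ ^ k) ^ (d - 1) * τ ^ (d - 1) * M := by
          apply mul_le_mul_of_nonneg_left _ (by positivity)
          rw [hM]; linarith

/-- ★★★ **CAMPANATO'S ITERATION LEMMA WITH AN `ε`-SLACK** ([Giaquinta1984] Ch. III Lemma 2.1, lattice form).  Let `d ≥ 1`, `A ≥ 1`, `B ≥ 0`, `ε(4A)^d ≤ A` (any sign), and let `ψ` be
nonnegative and nondecreasing on `[1, R₀]` with `ψ(P) ≤ (A (P∕R)^d + ε)·ψ(R) + B R^d` whenever `1 ≤ P ≤ R ≤ R₀`.  Then for all `1 ≤ P ≤ R ≤ R₀`: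
`ψ(P) ≤ 2 (4A)^{2(d−1)} (P∕R)^{d−1} (ψ(R) + B R^d)` (`τ = 1∕(4A)`; `iterate_step_eps`; monotonicity between `P` and the nearest `τ^k R ≥ P`).
[cite: Giaquinta1984, Ch. III Lemma 2.1 p.86; Balaban1984PropagatorsII, (1.9) p.226] -/
theorem campanato_iteration_eps {ψ : ℝ → ℝ} {A B ε R₀ : ℝ} {d : ℕ} (hd : 1 ≤ d) (hA : 1 ≤ A) (hB : 0 ≤ B) (hεA : ε * (4 * A) ^ d ≤ A)
    (hψ0 : ∀ t, 1 ≤ t → t ≤ R₀ → 0 ≤ ψ t)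
    (hmono : ∀ s t, 1 ≤ s → s ≤ t → t ≤ R₀ → ψ s ≤ ψ t)
    (hyp : ∀ P R, 1 ≤ P → P ≤ R → R ≤ R₀ → ψ P ≤ (A * (P / R) ^ d + ε) * ψ R + B * R ^ d) :
    ∀ P R, 1 ≤ P → P ≤ R → R ≤ R₀ → ψ P ≤ 2 * (4 * A) ^ (2 * (d - 1)) * (P / R) ^ (d - 1) * (ψ R + B * R ^ d) := by
  intro P R hP hPR hR
  set τ : ℝ := 1 / (4 * A) with hτ
  have hA0 : 0 < A := by linarith
  have hτ0 : 0 < τ := by rw [hτ]; positivity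
  have hτ1 : τ < 1 := by rw [hτ, div_lt_one (by positivity)]; linarith
  have hτA : τ * (4 * A) = 1 := by rw [hτ]; field_simp
  have hR1 : 1 ≤ R := hP.trans hPR
  have hR0 : 0 < R := by linarith
  have hψR : 0 ≤ ψ R := hψ0 R hR1 hR
  -- the least `k` with `τ^{k+1} R < P`
  have hex : ∃ k : ℕ, τ ^ (k + 1) * R < P := by
    obtain ⟨n, hn⟩ := exists_pow_lt_of_lt_one (show 0 < P / R by positivity) hτ1
    refine ⟨n, ?_⟩
    rw [lt_div_iff₀ hR0] at hn
    calc τ ^ (n + 1) * R = τ ^ n * R * τ := by rw [pow_succ]; ring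
      _ ≤ τ ^ n * R * 1 := mul_le_mul_of_nonneg_left hτ1.le (by positivity)
      _ = τ ^ n * R := mul_one _
      _ < P := hn
  classical
  let k := Nat.find hex
  have hk : τ ^ (k + 1) * R < P := Nat.find_spec hex
  have hkP : P ≤ τ ^ k * R := by
    by_cases hk0 : k = 0
    · rw [hk0, pow_zero, one_mul]; exact hPR
    · obtain ⟨j, hj⟩ := Nat.exists_eq_succ_of_ne_zero hk0
      have hmin := Nat.find_min hex (show j < k by omega)
      push Not at hmin
      rw [hj]; exact hmin
  have hk1 : 1 ≤ τ ^ k * R := hP.trans hkP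
  have hkR : τ ^ k * R ≤ R := by
    have : τ ^ k ≤ 1 := pow_le_one₀ hτ0.le hτ1.le
    nlinarith
  -- iterate
  have hiter := iterate_step_eps hd hA hB hεA hψ0 hyp hR1 hR k hk1
  -- monotonicity between `P` and `τ^k R`
  have h1 : ψ P ≤ ψ (τ ^ k * R) := hmono P _ hP hkP (hkR.trans hR)
  -- `τ^k ≤ (P/R)·(4A)`, so `τ^{k(d-1)} ≤ (P/R)^{d-1} (4A)^{d-1}`
  have hτk : τ ^ k ≤ P / R * (4 * A) := by
    have h2 : τ ^ k * τ * R < P := by rw [← pow_succ]; exact hk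
    have h3 : τ ^ k * R < P * (4 * A) := by
      have := mul_lt_mul_of_pos_right h2 (show (0:ℝ) < 4 * A by positivity)
      calc τ ^ k * R = τ ^ k * R * (τ * (4 * A)) := by rw [hτA, mul_one]
        _ = τ ^ k * τ * R * (4 * A) := by ring
        _ < P * (4 * A) := this
    rw [div_mul_eq_mul_div, le_div_iff₀ hR0]
    exact h3.le
  have hτkd : (τ ^ k) ^ (d - 1) ≤ (P / R) ^ (d - 1) * (4 * A) ^ (d - 1) := by
    rw [← mul_pow]; exact pow_le_pow_left₀ (by positivity) hτk _
  have hM : ψ R + 2 * B * R ^ d * (4 * A) ^ (d - 1) ≤ 2 * (4 * A) ^ (d - 1) * (ψ R + B * R ^ d) := by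
    have h4A : (1 : ℝ) ≤ (4 * A) ^ (d - 1) := one_le_pow₀ (by linarith)
    have : ψ R ≤ 2 * (4 * A) ^ (d - 1) * ψ R := by nlinarith
    nlinarith [mul_nonneg hB (pow_nonneg hR0.le d)]
  have hMnn : 0 ≤ ψ R + 2 * B * R ^ d * (4 * A) ^ (d - 1) := by positivity
  calc ψ P ≤ ψ (τ ^ k * R) := h1
    _ ≤ (τ ^ k) ^ (d - 1) * (ψ R + 2 * B * R ^ d * (4 * A) ^ (d - 1)) := hiter
    _ ≤ ((P / R) ^ (d - 1) * (4 * A) ^ (d - 1)) * (2 * (4 * A) ^ (d - 1) * (ψ R + B * R ^ d)) :=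
        mul_le_mul hτkd hM hMnn (by positivity)
    _ = 2 * (4 * A) ^ (2 * (d - 1)) * (P / R) ^ (d - 1) * (ψ R + B * R ^ d) := by rw [two_mul (d - 1), pow_add]; ring

/-- sanity (the `ε = 0` case is lit's hypothesis): under lit's `ψ(P) ≤ A(P∕R)^dψ(R) + BR^d` the slack lemma applies with `ε = 0` and returns the same exponent with the constant `4A`
for `2A` — so nothing is lost but a constant. [cite: Giaquinta1984, Ch. III Lemma 2.1 p.86] -/
theorem campanato_iteration_eps_zero {ψ : ℝ → ℝ} {A B R₀ : ℝ} {d : ℕ} (hd : 1 ≤ d) (hA : 1 ≤ A) (hB : 0 ≤ B)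
    (hψ0 : ∀ t, 1 ≤ t → t ≤ R₀ → 0 ≤ ψ t)
    (hmono : ∀ s t, 1 ≤ s → s ≤ t → t ≤ R₀ → ψ s ≤ ψ t)
    (hyp : ∀ P R, 1 ≤ P → P ≤ R → R ≤ R₀ → ψ P ≤ A * (P / R) ^ d * ψ R + B * R ^ d) :
    ∀ P R, 1 ≤ P → P ≤ R → R ≤ R₀ → ψ P ≤ 2 * (4 * A) ^ (2 * (d - 1)) * (P / R) ^ (d - 1) * (ψ R + B * R ^ d) :=
  campanato_iteration_eps hd hA hB (by rw [zero_mul]; linarith) hψ0 hmono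
    (fun P R hP hPR hR => by rw [add_zero]; exact hyp P R hP hPR hR)

end Summit.QuantumFields.YangMills.Theorems.Prop7CampanatoIterationEps

end
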